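import Literature.MathematicalPhysics.QuantumFieldTheory.Balaban1983to89.B13Sqrt27Accretive
import HarnessLib

/-!
# Route `UnitScaleTilt`, crux K1 «MinimiserStabilityRegPr» (stmt-QuantumFields-19200), EX rows `h349` ∕ `hGF` (curved member) — **LOD LINE ENGINE (L0″) OF LOCATE-P349-CT v2 §7
# (★p1 g24): THE FORM-RELATIVE (AGMON) COMBES–THOMAS BOUND, ABSTRACT** — if the `e^{φ}`-CONJUGATE of an accretive matrix is still accretive, the inverse decays like
# `e^{−(φ_i − φ_j)}`; with the family `φ_j = μ·d(·, j)` this is `‖A⁻¹ i j‖ ≤ (2∕m′)·e^{−μ d(i,j)}`.  The conjugate's accretivity is taken as a HYPOTHESIS (to be discharged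
# at a member by FORM-RELATIVE commutator bounds — the Agmon estimate — instead of lit's absolute Schur budget, which is not K-uniform for differential letters, memo §7 (E1));
# §2 records the one-line form-relative sufficient condition.

Cell `ym3-torus` (HUMAN RULING D-0037, YM ladder rung R3 — NOT d = 4, NOT a mass gap, NOT Clay).  Fleet lead seat `ym-ust-19200-p1` gen 24; ★★OWNER RULINGS №33∕№34 (LOD line
admissible; (L3′) = Thm 3.1-class Agmon brick via Track A's road).  THEOREMS ONLY (0 `def`, 0 `sorry`), Mathlib + lit ✓`B13Sqrt27Accretive.resolvent_bound_of_accretive`;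
`--supports stmt-QuantumFields-19200 --as helper`, count-neutral.  HONEST LABEL (№33 (6)): curved γ-row supplier line (LOD localisation); this is an ENGINE lemma (finite-dimensional
linear algebra); the member's form-relative commutator rows for `Δ_U + aQ″†Q″` ((L3′), Track A's `B9Thm31GpAgmon*Zd` road) and for the corrector equation ((L0′), namer w2 g11) are NOT
here; nothing of (3.49), Thm 3.1∕3.3, `h349`, `hGF`, EX ∕ 19200 is proved.

WHAT IS PROVED (ns `Summit.QuantumFields.YangMills.Theorems.Prop7AccretiveConjDecay`; `A : Matrix n n ℂ`; the conjugate by the weight `e^{φ}` is the matrix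
`(a,b) ↦ e^{φ a − φ b}·A a b`, lit's letter with `κρ ↦ φ`).
* §1 `inv_apply_eq_conj_inv` (undoing the conjugation on the inverse, lit's private lemma re-typed for a general `φ`); ★★ `norm_inv_apply_le_of_conj_accretive` — `A` accretive
  (for invertibility) and its `φ`-conjugate `m′`-accretive ⟹ `‖A⁻¹ i j‖ ≤ (2∕m′)·e^{−(φ i − φ j)}`; ★★★ `inv_decay_of_conj_accretive_family` — with `φ_j = μ·d(·,j)` for every
  column `j` (`d j j = 0`): `‖A⁻¹ i j‖ ≤ (2∕m′)·e^{−μ·d(i,j)}`.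
* §2 ★ `conj_accretive_of_formRelative` — if `Re Σ v̄((A_φ − A)v) ≥ −(θ·Re Σ v̄(Av) + δ‖v‖²)` with `θ ≤ 1` and `A` is `m`-accretive, then `A_φ` is `((1−θ)m − δ)`-accretive
  (the Agmon bookkeeping: the member supplies `θ, δ = O(μ)` from `[D_U, e^{φ}]` and `[Q″†Q″, e^{φ}]`, K-uniformly).

References: T. Bałaban, CMP **99** (1985) 389–434 [Balaban1985BackgroundPropagators] (Thm 3.1 (3.42)–(3.47) pp.397–398, (3.49) p.399); CMP **116** (1988) 1–22
[Balaban1988RG2Cluster] ((2.7) p.13); S. Agmon, *Lectures on exponential decay* (Princeton 1982), Ch. 1.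
-/

set_option autoImplicit false

noncomputable section

open scoped Matrix ComplexConjugate BigOperators
open Finset

namespace Summit.QuantumFields.YangMills.Theorems.Prop7AccretiveConjDecay

open Literature.MathematicalPhysics.QuantumFieldTheory.Balaban1983to89.B13Sqrt27Accretive (resolvent_bound_of_accretive)

variable {n : Type*} [Fintype n] [DecidableEq n]

/-! ## §1 Conjugate-accretive ⟹ weighted decay of the inverse -/

/-- Undoing the conjugation on the inverse: `(A⁻¹)_{ij} = e^{−(φ_i − φ_j)}·((E A E⁻¹)⁻¹)_{ij}` with `E = diag(e^{φ})` (lit's private `inv_apply_eq_conj_inv` for a general weight).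
[folklore] [cite: Balaban1988RG2Cluster, (2.7) p.13] -/
theorem inv_apply_eq_conj_inv (A : Matrix n n ℂ) (φ : n → ℝ) (hA : IsUnit A.det) (i j : n) :
    A⁻¹ i j = (Real.exp (-(φ i - φ j)) : ℂ) * (Matrix.of fun a b => (Real.exp (φ a - φ b) : ℂ) * A a b)⁻¹ i j := by
  set E : Matrix n n ℂ := Matrix.diagonal fun i => (Real.exp (φ i) : ℂ) with hE
  set E' : Matrix n n ℂ := Matrix.diagonal fun i => (Real.exp (-(φ i)) : ℂ) with hE'
  have hEE' : E * E' = 1 := by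
    rw [hE, hE', Matrix.diagonal_mul_diagonal, ← Matrix.diagonal_one]
    congr 1; funext i
    rw [← Complex.ofReal_mul, ← Real.exp_add, add_neg_cancel, Real.exp_zero, Complex.ofReal_one]
  have hE'E : E' * E = 1 := by
    rw [hE, hE', Matrix.diagonal_mul_diagonal, ← Matrix.diagonal_one]
    congr 1; funext i
    rw [← Complex.ofReal_mul, ← Real.exp_add, neg_add_cancel, Real.exp_zero, Complex.ofReal_one]
  have hconj : (Matrix.of fun a b => (Real.exp (φ a - φ b) : ℂ) * A a b) = E * A * E' := by
    ext a b
    simp only [Matrix.of_apply, hE, hE', Matrix.mul_apply, Matrix.diagonal_apply, mul_ite, mul_zero,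
      ite_mul, zero_mul, Finset.sum_ite_eq, Finset.sum_ite_eq', Finset.mem_univ, if_true]
    rw [Real.exp_sub, div_eq_mul_inv, ← Real.exp_neg]
    push_cast
    ring
  have hinv : (Matrix.of fun a b => (Real.exp (φ a - φ b) : ℂ) * A a b)⁻¹ = E * A⁻¹ * E' := by
    rw [hconj]
    refine Matrix.inv_eq_right_inv ?_
    calc E * A * E' * (E * A⁻¹ * E') = E * A * (E' * E) * A⁻¹ * E' := by simp only [Matrix.mul_assoc]
      _ = 1 := by rw [hE'E, Matrix.mul_one, Matrix.mul_assoc E A, Matrix.mul_nonsing_inv A hA, Matrix.mul_one, hEE']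
  rw [hinv]
  simp only [hE, hE', Matrix.mul_apply, Matrix.diagonal_apply, mul_ite, mul_zero, ite_mul, zero_mul,
    Finset.sum_ite_eq, Finset.sum_ite_eq', Finset.mem_univ, if_true]
  have h1 : Real.exp (-(φ i - φ j)) * Real.exp (φ i) * Real.exp (-(φ j)) = 1 := by
    rw [← Real.exp_add, ← Real.exp_add, ← Real.exp_zero]
    congr 1; ring
  calc A⁻¹ i j = ((Real.exp (-(φ i - φ j)) * Real.exp (φ i) * Real.exp (-(φ j)) : ℝ) : ℂ) * A⁻¹ i j := by rw [h1]; push_cast; ring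
    _ = (Real.exp (-(φ i - φ j)) : ℂ) * ((Real.exp (φ i) : ℂ) * A⁻¹ i j * (Real.exp (-(φ j)) : ℂ)) := by push_cast; ring

/-- ★★ **CONJUGATE-ACCRETIVE ⟹ WEIGHTED ENTRY BOUND**: `A` `m`-accretive (`m > 0`, used only for invertibility) and its `e^{φ}`-conjugate `m′`-accretive (`m′ > 0`) ⟹
`‖A⁻¹ i j‖ ≤ (2∕m′)·e^{−(φ i − φ j)}`. [cite: Balaban1988RG2Cluster, (2.7) p.13; Balaban1985BackgroundPropagators, Thm 3.1 p.397] -/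
theorem norm_inv_apply_le_of_conj_accretive (A : Matrix n n ℂ) (φ : n → ℝ) {m m' : ℝ} (hm : 0 < m) (hm' : 0 < m')
    (hacc : ∀ v : n → ℂ, m * ∑ i, ‖v i‖ ^ 2 ≤ (∑ i, star (v i) * (A *ᵥ v) i).re)
    (hconj : ∀ v : n → ℂ, m' * ∑ i, ‖v i‖ ^ 2 ≤ (∑ i, star (v i) * ((Matrix.of fun a b => (Real.exp (φ a - φ b) : ℂ) * A a b) *ᵥ v) i).re)
    (i j : n) : ‖A⁻¹ i j‖ ≤ 2 / m' * Real.exp (-(φ i - φ j)) := by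
  have hA : IsUnit A.det := by
    have h := (resolvent_bound_of_accretive A hm hacc le_rfl).1
    rwa [Complex.ofReal_zero, zero_smul, zero_add] at h
  have hC := resolvent_bound_of_accretive (Matrix.of fun a b => (Real.exp (φ a - φ b) : ℂ) * A a b) hm' hconj le_rfl
  rw [Complex.ofReal_zero, zero_smul, zero_add] at hC
  have hCij := hC.2 i j
  rw [add_zero] at hCij
  rw [inv_apply_eq_conj_inv A φ hA i j, norm_mul, Complex.norm_real, Real.norm_eq_abs, abs_of_pos (Real.exp_pos _), mul_comm]
  exact mul_le_mul_of_nonneg_right hCij (Real.exp_pos _).le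

/-- ★★★ **THE FORM-RELATIVE COMBES–THOMAS ∕ AGMON BOUND, FAMILY FORM**: if for EVERY column `j` the conjugate of `A` by the weight `e^{μ d(·,j)}` is `m′`-accretive, then
`‖A⁻¹ i j‖ ≤ (2∕m′)·e^{−μ d(i,j)}` (`d j j = 0`).  How a member discharges the hypothesis: `conj_accretive_of_formRelative` below with the commutator rows of its letters.
[cite: Balaban1985BackgroundPropagators, Thm 3.1 (3.46) p.398, (3.49) p.399] -/
theorem inv_decay_of_conj_accretive_family (d : n → n → ℝ) (hd0 : ∀ i, d i i = 0) (A : Matrix n n ℂ) {m m' μ : ℝ} (hm : 0 < m) (hm' : 0 < m')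
    (hacc : ∀ v : n → ℂ, m * ∑ i, ‖v i‖ ^ 2 ≤ (∑ i, star (v i) * (A *ᵥ v) i).re)
    (hconj : ∀ (j : n) (v : n → ℂ), m' * ∑ i, ‖v i‖ ^ 2 ≤
      (∑ i, star (v i) * ((Matrix.of fun a b => (Real.exp (μ * d a j - μ * d b j) : ℂ) * A a b) *ᵥ v) i).re) :
    IsUnit A.det ∧ ∀ i j, ‖A⁻¹ i j‖ ≤ 2 / m' * Real.exp (-(μ * d i j)) := by
  have hA : IsUnit A.det := by
    have h := (resolvent_bound_of_accretive A hm hacc le_rfl).1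
    rwa [Complex.ofReal_zero, zero_smul, zero_add] at h
  refine ⟨hA, fun i j => ?_⟩
  have h := norm_inv_apply_le_of_conj_accretive A (fun a => μ * d a j) hm hm' hacc (hconj j) i j
  rwa [hd0, mul_zero, sub_zero] at h

/-! ## §2 The form-relative sufficient condition (Agmon bookkeeping) -/

omit [DecidableEq n] in
/-- ★ **FORM-RELATIVE PERTURBATION KEEPS ACCRETIVITY**: if `A` is `m`-accretive and the conjugate `A_φ` satisfies
`Re Σ v̄((A_φ − A)v) ≥ −(θ·Re Σ v̄(Av) + δ·Σ|v|²)` with `θ ≤ 1`, then `A_φ` is `((1 − θ)m − δ)`-accretive.  (At a member: `θ, δ = O(μ)` from the commutators of the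
weight with `D_U` — relative to the Dirichlet form — and with the block mass — bounded.) [cite: Balaban1985BackgroundPropagators, Thm 3.1 p.397] -/
theorem conj_accretive_of_formRelative (A Aφ : Matrix n n ℂ) {m θ δ : ℝ} (hθ1 : θ ≤ 1)
    (hacc : ∀ v : n → ℂ, m * ∑ i, ‖v i‖ ^ 2 ≤ (∑ i, star (v i) * (A *ᵥ v) i).re)
    (hrel : ∀ v : n → ℂ, -(θ * (∑ i, star (v i) * (A *ᵥ v) i).re + δ * ∑ i, ‖v i‖ ^ 2) ≤ (∑ i, star (v i) * ((Aφ - A) *ᵥ v) i).re)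
    (v : n → ℂ) : ((1 - θ) * m - δ) * ∑ i, ‖v i‖ ^ 2 ≤ (∑ i, star (v i) * (Aφ *ᵥ v) i).re := by
  have hsplit : (∑ i, star (v i) * (Aφ *ᵥ v) i).re = (∑ i, star (v i) * (A *ᵥ v) i).re + (∑ i, star (v i) * ((Aφ - A) *ᵥ v) i).re := by
    rw [← Complex.add_re, ← Finset.sum_add_distrib]
    congr 1
    refine Finset.sum_congr rfl fun i _ => ?_
    rw [Matrix.sub_mulVec, Pi.sub_apply]; ring
  rw [hsplit]
  have h1 := hacc v
  have h2 := hrel v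
  have hS : 0 ≤ ∑ i, ‖v i‖ ^ 2 := Finset.sum_nonneg fun i _ => by positivity
  have h3 : (1 - θ) * (m * ∑ i, ‖v i‖ ^ 2) ≤ (1 - θ) * (∑ i, star (v i) * (A *ᵥ v) i).re := mul_le_mul_of_nonneg_left h1 (by linarith)
  nlinarith

end Summit.QuantumFields.YangMills.Theorems.Prop7AccretiveConjDecay

end
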